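import Summits.BirchSwinnertonDyer.Rank1Residual.P2.CongruentNumberGenusDoorsNoGZK
import Summits.BirchSwinnertonDyer.Rank1Residual.P2.CongruentNumberCor515SelmerEight
import Summits.BirchSwinnertonDyer.Rank1Residual.P2.TianFamilySevenAtTwo
import Summits.BirchSwinnertonDyer.Rank1Residual.P2.CongruentNumberPairsAtTwoEvenFiveFamily
import Summits.BirchSwinnertonDyer.Rank1Residual.P2.CongruentNumberPairsAtTwoThreeSevenFamily
import Summits.BirchSwinnertonDyer.Rank1Residual.P2.CongruentNumberPairsAtTwoEvenAtlasThree
import Literature.NumberTheory.EllipticCurves.Tian2014.ClassSixFamilyDescentProofs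
import Literature.NumberTheory.EllipticCurves.CongruentNumberEvenMonskySelmerExact
import Literature.NumberTheory.EllipticCurves.CongruentNumberMonskySelmerParityBound
import HarnessLib

/-!
# Cell `bsd-print-cf2` (leaf CornerF @ `p = 2`, row B14), prover p2 — the `2`-DESCENT-MATRIX ROAD WITHOUT
# GROSS–ZAGIER–KOLYVAGIN, file 2/2: the uniform rank-one FAMILIES of `B14 ∩ {j = 1728}` from ONE displayed
# source (`tyz_genusPointData`) — `q₇`, `p₃q₅`, `p₃q₇`, `p₁q₇`, `2p₅q`, Tian's class-`6`/`7` families, `p₁q₃r₅`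

HONEST FRAMING (cell `bsd-print-cf2`, HOME `run/shared/lean/pub/bsd-print-cf2/`; PARTITION currency). The leaf
is `CornerF W 2 = HasCM ∧ analyticRank = 1` at `p = 2` (row B14; `0` census cells, OPEN AS A CLASS). NO
arithmetic fact is asserted: every theorem is a kernel theorem MODULO the single named journal fact
`hTYZ : TianYuanZhang2017.tyz_genusPointData` (Tian–Yuan–Zhang, Asian J. Math. 21 (2017), §3, displayed sentence
by sentence). File 1/2 (`CongruentNumberGenusDoorsNoGZK.lean`) built the doors in which Gross–Zagier–Kolyvagin
is replaced by kernel `2`-descent (`#Sel⁽²⁾(E_n/ℚ) = 8 ⟹ rank ≤ 1`; rank `0` ⟹ genus sums even, from the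
display; Miller's `BSD(E, 2)` needs only `Ш[2^∞]`). Here the doors are evaluated on the families whose
`2`-Selmer count and genus parities are TREE THEOREMS, so that for EVERY member, with NO per-member input and NO
second displayed fact, `ord_{s=1} L(E_n, s) = 1`, `rank E_n(ℚ) = 1`, `Ш(E_n)[2^∞] = 0` and `BSD(E_n, 2)` hold
modulo `hTYZ` alone:
* every prime `q ≡ 7 (mod 8)` (Monsky's one-prime table; `g(q)` odd);
* every `p·q` with `p ≡ 3`, `q ≡ 5 (mod 8)`; every `p·q` with `p ≡ 3`, `q ≡ 7 (mod 8)`; every `2·p·q` with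
  `p ≡ 5 (mod 8)`, `q ≡ 3 (mod 4)`, `(p/q) = +1` (Monsky's matrices at `k = 2`: the Cor. 5.15 Selmer clause in
  the kernel; genus parities by Rédei–Reichardt, a tree theorem);
* Tian's 2014 class-`7` family `n = p₀⋯p_k` (`p₀ ≡ 7`, `pᵢ ≡ 1 (mod 8)`, odd graph) and class-`6` family
  `2p₀⋯p_k` (`p₀ ≡ 3 (mod 4)`, `pᵢ ≡ 1 (mod 8)`, odd graph), UNIFORMLY IN `k` (Tian's Lemma 5.3 through Monsky's
  matrices, tree theorems); the slice `p₁·q₇` with `(p/q) = −1`;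
* the sample `ω = 3` configuration family `p₁·q₃·r₅` with `(q/p) = −1`.
Previously (p533057, p533567 and the sub-lane «bsd-p2» doors) each of these displayed `hGZK` (and before that
`hM`/`hMe`, `hR`, `h515`, `h13`). "Beyond-print theorem": NO new statement (Tian ICM 2022 Thm 8 / LLT / TYZ
assert the `2`-part on these families); new is the DERIVATION from one displayed source without Kolyvagin's
Euler system and without the finiteness of `Ш`. Nothing booked; no mark moved; `0` census cells.
Unit `bsd-print-cf2-p2` g0; NEW file.

References: [TianYuanZhang2017] §3, Thm 1.2; [Tian2014] Thm 1.3, Lemmas 5.1, 5.3; [Monsky1990MockHeegner]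
Cor 5.15, Remark (2); [HeathBrown1994SelmerCongruentII] Appendix (Monsky); [LiMa2008] Thm 0.4;
[Miller2011LMS] Def 1.1; [Tian2023CongruentICM] Thm 8.
-/

noncomputable section

open scoped Classical

open Matrix Finset WeierstrassCurve NumberField Literature.NumberTheory.EllipticCurves
  Literature.NumberTheory.EllipticCurves.Rank1Residual
  Literature.NumberTheory.EllipticCurves.Rank1Residual.Typed
  Literature.NumberTheory.EllipticCurves.Monsky1990
  Literature.NumberTheory.EllipticCurves.HeathBrown1994
  Literature.NumberTheory.EllipticCurves.HeathBrown1994.Families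
  Literature.NumberTheory.EllipticCurves.TianYuanZhang2017
  Literature.NumberTheory.EllipticCurves.Tian2014
  Literature.NumberTheory.EllipticCurves.MonskySelmerParity
  Literature.NumberTheory.QuadraticFields.RedeiReichardt

set_option autoImplicit false

namespace Summit.BirchSwinnertonDyer.Rank1Residual.P2

/-! ## §1 Primes and two-prime families -/

section TwoPrimes

/-- **Every prime `q ≡ 7 (mod 8)`, WITHOUT GZK**: `ord_{s=1} L(E_q, s) = 1`, rank `1`, `Ш(E_q)[2^∞] = 0`,
`BSD(E_q, 2)` — modulo `hTYZ` alone (`#Sel₂(E_q) = 8` by Monsky's one-prime table; `Σ₁(q) = g(q)` odd by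
Rédei–Reichardt at `t = 1`). [cite: TianYuanZhang2017, Thm. 3.5 and its proof; §1 (1.1)]
[cite: HeathBrown1994SelmerCongruentII, §1 typescript p. 6 (one-prime Selmer ranks)]
[cite: Miller2011LMS, Def. 1.1 (arXiv:1010.2431 p. 3)] -/
theorem rankOne_sha_bsdp_two_congruentNumberCurve_prime_seven_mod_eight_noGZK (hTYZ : tyz_genusPointData)
    {q : ℕ} (hq : q.Prime) (h8 : q % 8 = 7) :
    haveI := isElliptic_congruentNumberCurve hq.ne_zero
    (congruentNumberCurve q).analyticRank = 1 ∧ (congruentNumberCurve q).mordellWeilRank = 1 ∧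
      AddCommGroup.primaryComponent (congruentNumberCurve q).sha 2 = ⊥ ∧
      BSDp (congruentNumberCurve q) 2 := by
  have hsel : Nat.card ((congruentNumberCurve q).selmerGroup 2) = 8 := by
    rw [card_selmerGroup_two_congruentNumberCurve_prime hq (by omega), if_neg (by omega), if_neg (by omega)]
  exact rankOne_sha_bsdp_two_congruentNumberCurve_of_selmerEight_noGZK hTYZ hq.squarefree (Or.inr h8) hsel
    (Or.inl (odd_genusSum₁_genusField_prime redeiReichardt_fourTwoCard_classGroup_holds hq (by omega)))

/-- **`BSD(E_q, 2)` for EVERY prime `q ≡ 7 (mod 8)`, WITHOUT GZK** (`∀`-form), modulo `hTYZ` alone.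
[cite: TianYuanZhang2017, Thm. 3.5 and its proof] [cite: Miller2011LMS, Def. 1.1 (arXiv:1010.2431 p. 3)] -/
theorem forall_bsdp_two_congruentNumberCurve_prime_seven_mod_eight_noGZK (hTYZ : tyz_genusPointData) :
    ∀ q : ℕ, q.Prime → q % 8 = 7 → BSDp (congruentNumberCurve q) 2 :=
  fun _ hq h8 => (rankOne_sha_bsdp_two_congruentNumberCurve_prime_seven_mod_eight_noGZK hTYZ hq h8).2.2.2

/-- **Every `p·q`, `p ≡ 3`, `q ≡ 5 (mod 8)`, WITHOUT GZK**: `ord = 1`, rank `1`, `Ш[2^∞] = 0`, `BSD(E_{pq}, 2)` —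
modulo `hTYZ` alone (`#Sel₂ = 8`: Cor. 5.15 family (2) in the kernel; `Σ₁` or `Σ₂′` odd by Rédei–Reichardt).
[cite: TianYuanZhang2017, Thm. 3.5 and its proof; §1 (1.1)] [cite: Monsky1990MockHeegner, Cor. 5.15 (2), Remark (2)]
[cite: Miller2011LMS, Def. 1.1 (arXiv:1010.2431 p. 3)] -/
theorem rankOne_sha_bsdp_two_congruentNumberCurve_three_five_noGZK (hTYZ : tyz_genusPointData)
    {p q : ℕ} (hp : p.Prime) (hq : q.Prime) (hp3 : p % 8 = 3) (hq5 : q % 8 = 5) :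
    haveI := isElliptic_congruentNumberCurve (Nat.mul_ne_zero hp.ne_zero hq.ne_zero)
    (congruentNumberCurve (p * q)).analyticRank = 1 ∧ (congruentNumberCurve (p * q)).mordellWeilRank = 1 ∧
      AddCommGroup.primaryComponent (congruentNumberCurve (p * q)).sha 2 = ⊥ ∧
      BSDp (congruentNumberCurve (p * q)) 2 := by
  have hN : IsCor515Family (p * q) := Or.inr (Or.inr (Or.inl ⟨p, q, hp, hq, hp3, Or.inr hq5, rfl⟩))
  have h8 : (p * q) % 8 = 7 := by rw [Nat.mul_mod, hp3, hq5]
  exact rankOne_sha_bsdp_two_congruentNumberCurve_of_selmerEight_noGZK hTYZ hN.squarefree (Or.inr h8)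
    (card_selmerGroup_two_eq_eight_of_isCor515Family hN)
    (odd_genusSum_genusField_three_five' redeiReichardt_fourTwoCard_classGroup_holds hp hq hp3 hq5)

/-- **`BSD(E_{pq}, 2)` for ALL primes `p ≡ 3`, `q ≡ 5 (mod 8)`, WITHOUT GZK** (`∀`-form), modulo `hTYZ` alone.
[cite: TianYuanZhang2017, Thm. 3.5 and its proof] [cite: Miller2011LMS, Def. 1.1 (arXiv:1010.2431 p. 3)] -/
theorem forall_bsdp_two_congruentNumberCurve_three_five_noGZK (hTYZ : tyz_genusPointData) :
    ∀ p q : ℕ, p.Prime → q.Prime → p % 8 = 3 → q % 8 = 5 → BSDp (congruentNumberCurve (p * q)) 2 :=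
  fun _ _ hp hq hp3 hq5 => (rankOne_sha_bsdp_two_congruentNumberCurve_three_five_noGZK hTYZ hp hq hp3 hq5).2.2.2

/-- **Every `p·q`, `p ≡ 3`, `q ≡ 7 (mod 8)`, WITHOUT GZK**: `ord = 1`, rank `1`, `Ш[2^∞] = 0`, `BSD(E_{pq}, 2)` —
modulo `hTYZ` alone (`#Sel₂ = 8`: Cor. 5.15 family (2) in the kernel; `Σ₁` or `Σ₂′` odd since `g(p)`, `g(q)` are
odd). [cite: TianYuanZhang2017, Thm. 3.5 and its proof; §1 (1.1)] [cite: Monsky1990MockHeegner, Cor. 5.15 (2), Remark (2)]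
[cite: Miller2011LMS, Def. 1.1 (arXiv:1010.2431 p. 3)] -/
theorem rankOne_sha_bsdp_two_congruentNumberCurve_three_seven_noGZK (hTYZ : tyz_genusPointData)
    {p q : ℕ} (hp : p.Prime) (hq : q.Prime) (hp3 : p % 8 = 3) (hq7 : q % 8 = 7) :
    haveI := isElliptic_congruentNumberCurve (Nat.mul_ne_zero hp.ne_zero hq.ne_zero)
    (congruentNumberCurve (p * q)).analyticRank = 1 ∧ (congruentNumberCurve (p * q)).mordellWeilRank = 1 ∧
      AddCommGroup.primaryComponent (congruentNumberCurve (p * q)).sha 2 = ⊥ ∧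
      BSDp (congruentNumberCurve (p * q)) 2 := by
  have hN : IsCor515Family (p * q) := Or.inr (Or.inr (Or.inl ⟨p, q, hp, hq, hp3, Or.inl hq7, rfl⟩))
  have h8 : (p * q) % 8 = 5 := by rw [Nat.mul_mod, hp3, hq7]
  exact rankOne_sha_bsdp_two_congruentNumberCurve_of_selmerEight_noGZK hTYZ hN.squarefree (Or.inl h8)
    (card_selmerGroup_two_eq_eight_of_isCor515Family hN)
    (odd_genusSum_genusField_three_seven redeiReichardt_fourTwoCard_classGroup_holds hp hq hp3 hq7)

/-- **`BSD(E_{pq}, 2)` for ALL primes `p ≡ 3`, `q ≡ 7 (mod 8)`, WITHOUT GZK** (`∀`-form), modulo `hTYZ` alone.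
[cite: TianYuanZhang2017, Thm. 3.5 and its proof] [cite: Miller2011LMS, Def. 1.1 (arXiv:1010.2431 p. 3)] -/
theorem forall_bsdp_two_congruentNumberCurve_three_seven_noGZK (hTYZ : tyz_genusPointData) :
    ∀ p q : ℕ, p.Prime → q.Prime → p % 8 = 3 → q % 8 = 7 → BSDp (congruentNumberCurve (p * q)) 2 :=
  fun _ _ hp hq hp3 hq7 => (rankOne_sha_bsdp_two_congruentNumberCurve_three_seven_noGZK hTYZ hp hq hp3 hq7).2.2.2

/-- **Every `2·p·q`, `p ≡ 5 (mod 8)`, `q ≡ 3 (mod 4)`, `(p/q) = +1`, WITHOUT GZK** (the U⁺ half of Monsky's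
even-five family; the other half is `𝒮⁻`, the `bsd-monsky` M row): `ord = 1`, rank `1`, `Ш[2^∞] = 0`,
`BSD(E_{2pq}, 2)` — modulo `hTYZ` alone (`#Sel₂ = 8`: Cor. 5.15 family (2′) in the kernel; `Σ₂′(2pq)` odd).
[cite: TianYuanZhang2017, Thm. 3.5 and its proof; §1 (1.1)] [cite: Monsky1990MockHeegner, Cor. 5.15 (2′), Remark (2)]
[cite: Miller2011LMS, Def. 1.1 (arXiv:1010.2431 p. 3)] -/
theorem rankOne_sha_bsdp_two_congruentNumberCurve_two_mul_five_mul_noGZK (hTYZ : tyz_genusPointData)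
    {p q : ℕ} (hp : p.Prime) (hq : q.Prime) (hp5 : p % 8 = 5) (hq4 : q % 4 = 3) (hj : jacobiSym p q = 1) :
    haveI := isElliptic_congruentNumberCurve
      (Nat.mul_ne_zero two_ne_zero (Nat.mul_ne_zero hp.ne_zero hq.ne_zero))
    (congruentNumberCurve (2 * (p * q))).analyticRank = 1 ∧
      (congruentNumberCurve (2 * (p * q))).mordellWeilRank = 1 ∧
      AddCommGroup.primaryComponent (congruentNumberCurve (2 * (p * q))).sha 2 = ⊥ ∧
      BSDp (congruentNumberCurve (2 * (p * q))) 2 := by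
  have hq8 : q % 8 = 3 ∨ q % 8 = 7 := by omega
  have hN : IsCor515Family (2 * (p * q)) :=
    Or.inr (Or.inr (Or.inr (Or.inl ⟨p, q, hp, hq, hp5, hq8, rfl⟩)))
  have h6 : (2 * (p * q)) % 8 = 6 := by
    have : (p * q) % 4 = 3 := by rw [Nat.mul_mod, show p % 4 = 1 by omega, hq4]
    omega
  exact rankOne_sha_bsdp_two_congruentNumberCurve_of_selmerEight_six_noGZK hTYZ hN.squarefree h6
    (card_selmerGroup_two_eq_eight_of_isCor515Family hN)
    (odd_genusSum₂'_genusField_two_mul_five_mul redeiReichardt_fourTwoCard_classGroup_holds hp hq hp5 hq4 hj)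

/-- **`BSD(E_{2pq}, 2)` for ALL primes `p ≡ 5 (mod 8)`, `q ≡ 3 (mod 4)` with `(p/q) = +1`, WITHOUT GZK**
(`∀`-form), modulo `hTYZ` alone. [cite: TianYuanZhang2017, Thm. 3.5 and its proof]
[cite: Miller2011LMS, Def. 1.1 (arXiv:1010.2431 p. 3)] -/
theorem forall_bsdp_two_congruentNumberCurve_two_mul_five_mul_noGZK (hTYZ : tyz_genusPointData) :
    ∀ p q : ℕ, p.Prime → q.Prime → p % 8 = 5 → q % 4 = 3 → jacobiSym p q = 1 →
      BSDp (congruentNumberCurve (2 * (p * q))) 2 :=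
  fun _ _ hp hq hp5 hq4 hj =>
    (rankOne_sha_bsdp_two_congruentNumberCurve_two_mul_five_mul_noGZK hTYZ hp hq hp5 hq4 hj).2.2.2

end TwoPrimes

/-! ## §2 Tian's 2014 families, uniformly in `k`, without GZK -/

section TianFamilies

variable {k : ℕ} (p : Fin (k + 1) → ℕ)

/-- **TIAN'S CLASS-`7` FAMILY WITHOUT GZK.** For `n = p₀p₁⋯p_k` with distinct primes `p₀ ≡ 7`, `pᵢ ≡ 1 (mod 8)`
(`i ≥ 1`) and odd Legendre graph (`hG`): `ord_{s=1} L(E_n, s) = 1`, rank `1`, `Ш(E_n)[2^∞] = 0`, `BSD(E_n, 2)` —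
modulo `hTYZ` alone. Tree theorems used: Monsky kernel count `2` (`card_ker_monskyMatrixOdd_caseSeven`, Tian's
Lemma 5.3 through Monsky's matrix), `Σ₁(n)` odd (`odd_genusSum₁_caseSeven`, Rédei–Reichardt `_holds`).
[cite: Tian2014, Thm. 1.3, Lemma 5.1, Lemma 5.3 (arXiv pp. 2, 28–29)] [cite: TianYuanZhang2017, Thm. 3.5 and its proof]
[cite: HeathBrown1994SelmerCongruentII, Appendix (Monsky), typescript p. 39 L10–L33] [cite: Miller2011LMS, Def. 1.1] -/
theorem rankOne_sha_bsdp_two_congruentNumberCurve_caseSeven_noGZK (hTYZ : tyz_genusPointData)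
    (hp : ∀ i, (p i).Prime) (hinj : Function.Injective p) (h7 : p 0 % 8 = 7)
    (h1 : ∀ i, i ≠ 0 → p i % 8 = 1) (hG : ∀ v, legendreMatrix p *ᵥ v = 0 → v = 0 ∨ v = fun _ => 1)
    {n : ℕ} (hn : ∏ i, p i = n) :
    haveI := isElliptic_congruentNumberCurve (hn ▸ (squarefree_prod_of_injective p hp hinj).ne_zero)
    (congruentNumberCurve n).analyticRank = 1 ∧ (congruentNumberCurve n).mordellWeilRank = 1 ∧
      AddCommGroup.primaryComponent (congruentNumberCurve n).sha 2 = ⊥ ∧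
      BSDp (congruentNumberCurve n) 2 :=
  rankOne_sha_bsdp_two_congruentNumberCurve_of_card_ker_noGZK p hTYZ hp (odd_of_caseSeven p h7 h1) hinj hn
    (Or.inr (hn ▸ prod_mod_eight_caseSeven p h7 h1)) (card_ker_monskyMatrixOdd_caseSeven p h7 h1 hG)
    (Or.inl (odd_genusSum₁_caseSeven p redeiReichardt_fourTwoCard_classGroup_holds hp hinj h7 h1 hG hn))

/-- **`BSD(E_n, 2)` on Tian's class-`7` family, quantified, WITHOUT GZK** — modulo `hTYZ` alone.
[cite: Tian2014, Thm. 1.3 with Lemma 5.1] [cite: TianYuanZhang2017, Thm. 3.5] [cite: Miller2011LMS, Def. 1.1] -/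
theorem forall_bsdp_two_congruentNumberCurve_caseSeven_noGZK (hTYZ : tyz_genusPointData) :
    ∀ (k : ℕ) (p : Fin (k + 1) → ℕ), (∀ i, (p i).Prime) → Function.Injective p → p 0 % 8 = 7 →
      (∀ i, i ≠ 0 → p i % 8 = 1) → (∀ v, legendreMatrix p *ᵥ v = 0 → v = 0 ∨ v = fun _ => 1) →
      BSDp (congruentNumberCurve (∏ i, p i)) 2 :=
  fun _ p hp hinj h7 h1 hG =>
    (rankOne_sha_bsdp_two_congruentNumberCurve_caseSeven_noGZK p hTYZ hp hinj h7 h1 hG rfl).2.2.2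

/-- **The slice `p₁·q₇`, `(p/q) = −1`, WITHOUT GZK**: `BSD(E_{pq}, 2)` for ALL primes `p ≡ 1`, `q ≡ 7 (mod 8)` with
`(p/q) = −1`, modulo `hTYZ` alone (`k = 1` of the class-`7` family; odd graph ⟺ `(p/q) = −1`).
[cite: Tian2014, Thm. 1.3 with Lemma 5.1] [cite: Monsky1990MockHeegner, Cor. 5.15 (3)] [cite: Miller2011LMS, Def. 1.1] -/
theorem forall_bsdp_two_congruentNumberCurve_one_seven_noGZK (hTYZ : tyz_genusPointData) :
    ∀ p q : ℕ, p.Prime → q.Prime → p % 8 = 1 → q % 8 = 7 → jacobiSym p q = -1 →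
      BSDp (congruentNumberCurve (p * q)) 2 := by
  intro p q hp hq h1 h7 hJ
  have hne : q ≠ p := fun h => by omega
  have hinj : Function.Injective (![q, p] : Fin 2 → ℕ) := by
    intro i j h
    fin_cases i <;> fin_cases j <;> simp_all [hne.symm]
  have h := forall_bsdp_two_congruentNumberCurve_caseSeven_noGZK hTYZ 1 ![q, p]
    (fun i => by fin_cases i <;> assumption) hinj h7 (fun i hi => by fin_cases i <;> simp_all)
    (oddGraph_one_seven hq h1 h7 hJ)
  simpa [Fin.prod_univ_two, mul_comm] using h

/-- **TIAN'S CLASS-`6` FAMILY WITHOUT GZK.** For `n = p₀p₁⋯p_k` with distinct primes `p₀ ≡ 3 (mod 4)`,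
`pᵢ ≡ 1 (mod 8)` (`i ≥ 1`) and odd Legendre graph: for `E_{2n}`, `ord_{s=1} L(E_{2n}, s) = 1`, rank `1`,
`Ш(E_{2n})[2^∞] = 0`, `BSD(E_{2n}, 2)` — modulo `hTYZ` alone. Tree theorems used: `s(2n) = 1`
(`monskySelmerRankEven_caseSix`) + Monsky's even formula with equality ⟹ `#Sel₂(E_{2n}) = 8`; `Σ₂′(2n)` odd
(`odd_genusSum₂'_two_mul_caseSix`). [cite: Tian2014, Thm. 1.3, Lemma 5.1, Lemma 5.3, Thm. 5.2]
[cite: TianYuanZhang2017, Thm. 3.5 and its proof] [cite: HeathBrown1994SelmerCongruentII, Appendix (Monsky), typescript p. 41 L20–L36]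
[cite: Miller2011LMS, Def. 1.1 (arXiv:1010.2431 p. 3)] -/
theorem rankOne_sha_bsdp_two_congruentNumberCurve_two_mul_caseSix_noGZK (hTYZ : tyz_genusPointData)
    (hp : ∀ i, (p i).Prime) (hinj : Function.Injective p) (h3 : p 0 % 4 = 3)
    (h1 : ∀ i, i ≠ 0 → p i % 8 = 1) (hG : ∀ v, legendreMatrix p *ᵥ v = 0 → v = 0 ∨ v = fun _ => 1)
    {n : ℕ} (hn : ∏ i, p i = n) :
    haveI := isElliptic_congruentNumberCurve
      (show 2 * n ≠ 0 from hn ▸ (squarefree_two_mul_prod_of_injective p hp (odd_of_caseSix p h3 h1) hinj).ne_zero)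
    (congruentNumberCurve (2 * n)).analyticRank = 1 ∧ (congruentNumberCurve (2 * n)).mordellWeilRank = 1 ∧
      AddCommGroup.primaryComponent (congruentNumberCurve (2 * n)).sha 2 = ⊥ ∧
      BSDp (congruentNumberCurve (2 * n)) 2 := by
  have hodd := odd_of_caseSix p h3 h1
  have hsq : Squarefree (2 * n) := hn ▸ squarefree_two_mul_prod_of_injective p hp hodd hinj
  have h6 : (2 * n) % 8 = 6 := by rw [← hn]; exact two_mul_prod_mod_eight_caseSix p h3 h1
  have hsel : Nat.card ((congruentNumberCurve (2 * n)).selmerGroup 2) = 8 := by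
    subst hn
    rw [monsky_card_selmerGroup_two_even_holds (k + 1) p hp hodd hinj, monskySelmerRankEven_caseSix p h3 h1 hG]
    norm_num
  exact rankOne_sha_bsdp_two_congruentNumberCurve_of_selmerEight_six_noGZK hTYZ hsq h6 hsel
    (odd_genusSum₂'_two_mul_caseSix p redeiReichardt_fourTwoCard_classGroup_holds hp hinj h3 h1 hG hn)

/-- **`BSD(E_{2n}, 2)` on Tian's class-`6` family, quantified, WITHOUT GZK** — modulo `hTYZ` alone.
[cite: Tian2014, Thm. 1.3 and Thm. 5.2] [cite: TianYuanZhang2017, Thm. 3.5] [cite: Miller2011LMS, Def. 1.1] -/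
theorem forall_bsdp_two_congruentNumberCurve_two_mul_caseSix_noGZK (hTYZ : tyz_genusPointData) :
    ∀ (k : ℕ) (p : Fin (k + 1) → ℕ), (∀ i, (p i).Prime) → Function.Injective p → p 0 % 4 = 3 →
      (∀ i, i ≠ 0 → p i % 8 = 1) → (∀ v, legendreMatrix p *ᵥ v = 0 → v = 0 ∨ v = fun _ => 1) →
      BSDp (congruentNumberCurve (2 * ∏ i, p i)) 2 :=
  fun _ p hp hinj h3 h1 hG =>
    (rankOne_sha_bsdp_two_congruentNumberCurve_two_mul_caseSix_noGZK p hTYZ hp hinj h3 h1 hG rfl).2.2.2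

end TianFamilies

/-! ## §3 A three-prime configuration family without GZK -/

/-- **The sample family `p₁·q₃·r₅` with `(q/p) = −1`, WITHOUT GZK**: `BSD(E_{pqr}, 2)` for ALL primes `p ≡ 1`,
`q ≡ 3`, `r ≡ 5 (mod 8)` with `(q/p) = −1` — modulo `hTYZ` alone (the upper-bits door with `doorACfg` decided
on the `4` configurations `(1, 3, 5; 1, s₁, s₂)`). [cite: TianYuanZhang2017, Thm. 3.5 and its proof; §1 (1.1)]
[cite: IrelandRosen1990, Ch. 5 §1 Prop. 5.1.2] [cite: Miller2011LMS, Def. 1.1 (arXiv:1010.2431 p. 3)] -/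
theorem forall_bsdp_two_congruentNumberCurve_one_three_five_noGZK (hTYZ : tyz_genusPointData) :
    ∀ p q r : ℕ, p.Prime → q.Prime → r.Prime → p % 8 = 1 → q % 8 = 3 → r % 8 = 5 →
      jacobiSym q p = -1 → BSDp (congruentNumberCurve (p * q * r)) 2 := by
  intro p q r hp hq hr h1 h3 h5 hj
  have key : ∀ s₁ s₂ : ZMod 2, doorACfg ![1, 3, 5] (betaOf ![1, 3, 5] ![1, s₁, s₂]) = true := by
    decide
  have hpq : p ≠ q := fun h => by omega
  have hpr : p ≠ r := fun h => by omega
  have hqr : q ≠ r := fun h => by omega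
  have hs₀ : kroneckerBit q p = 1 := by
    rw [kroneckerBit_eq_bitOf hp (by omega) (intCast_natCast_prime_ne_zero hq hp hpq.symm)]
    simp [bitOf, hj]
  exact (bsdp_two_congruentNumberCurve_three_primes_of_doorACfg_noGZK hTYZ ⟨1, by norm_num⟩
    ⟨3, by norm_num⟩ ⟨5, by norm_num⟩ 1 (kroneckerBit r p) (kroneckerBit r q) (key _ _) hp hq hr hpq
    hpr hqr h1 h3 h5 hs₀ rfl rfl).2

/-! ## §4 (APPENDED) The even `ω(m) = 3` atlas without GZK -/

section EvenAtlas

variable (p : Fin 3 → ℕ)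

/-- **DOOR B6 ON THE EVEN `ω(m) = 3` ATLAS, WITHOUT GZK.** For distinct odd primes `p₀, p₁, p₂` with
`n = 2p₀p₁p₂ ≡ 6 (mod 8)`, `s(n) = 1` (Monsky even rank) and a NON-silent configuration
(`silentEvenCfg … = false`): `ord_{s=1} L(E_n, s) = 1`, rank `1`, `Ш(E_n)[2^∞] = 0`, `BSD(E_n, 2)` — modulo
`hTYZ` ALONE (twin of `rankOne_sha_bsdp_two_congruentNumberCurve_two_mul_three_of_not_silent`, which displays
`hGZK`, `hMe`, `hR`; here Monsky's even formula and Rédei–Reichardt are tree theorems and the door is the GZK-free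
`…_of_selmerEight_six_noGZK`). [cite: TianYuanZhang2017, Thm. 3.5 and its proof; §1 (1.1)]
[cite: HeathBrown1994SelmerCongruentII, Appendix (Monsky), typescript p. 41 L20–L36]
[cite: Miller2011LMS, Def. 1.1 (arXiv:1010.2431 p. 3)] -/
theorem rankOne_sha_bsdp_two_congruentNumberCurve_two_mul_three_of_not_silent_noGZK
    (hTYZ : tyz_genusPointData)
    (hp : ∀ i, (p i).Prime) (hinj : Function.Injective p) {n : ℕ} (hn : 2 * ∏ i, p i = n)
    (h8 : n % 8 = 6) (hs : monskySelmerRankEven p = 1)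
    (hns : silentEvenCfg (fun i => p i % 8) (fun a b => kroneckerBit (p b) (p a)) = false) :
    haveI := isElliptic_congruentNumberCurve
      (hn ▸ (squarefree_two_mul_prod_of_injective p hp
        (fun i => (hp i).odd_of_ne_two (ne_two_of_two_mul_prod_mod_eight_six p (by rw [hn]; exact h8) i))
        hinj).ne_zero)
    (congruentNumberCurve n).analyticRank = 1 ∧ (congruentNumberCurve n).mordellWeilRank = 1 ∧
      AddCommGroup.primaryComponent (congruentNumberCurve n).sha 2 = ⊥ ∧
      BSDp (congruentNumberCurve n) 2 := by
  have h8' : (2 * ∏ i, p i) % 8 = 6 := by rw [hn]; exact h8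
  have hp2 := ne_two_of_two_mul_prod_mod_eight_six p h8'
  have hodd : ∀ i, Odd (p i) := fun i => (hp i).odd_of_ne_two (hp2 i)
  have hsq : Squarefree n := hn ▸ squarefree_two_mul_prod_of_injective p hp hodd hinj
  obtain ⟨r₀, r₁, r₂, ⟨e₀, e₁, e₂⟩, hRfun, hBfun⟩ := cfg_three_eq_betaOf p hp hp2 hinj
  have h4 : (r₀.val * r₁.val * r₂.val) % 4 = 3 := by
    rw [e₀, e₁, e₂]; exact cfg_prod_mod_four_of_two_mul p h8'
  have hk : Fintype.card {v : Fin 3 ⊕ Fin 3 → ZMod 2 // monskyMatrixEven p *ᵥ v = 0} = 2 :=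
    (monskySelmerRankEven_eq_one_iff_card_ker p).mp hs
  have hkc := hk
  rw [card_ker_monskyMatrixEven_eq_cfg p hp hp2 hinj, hRfun, hBfun] at hkc
  rw [hRfun, hBfun] at hns
  have hσ := evenSigmaCfg_eq_one_of_card_ker_of_not_silent r₀ r₁ r₂ _ _ _ h4 hkc hns
  have hgen : Odd (genusSum₂' n fun d => genusClassNumber (GenusField d)) := by
    rw [← ZMod.natCast_eq_one_iff_odd, ← hn, natCast_genusSum₂'_two_mul_three_eq_cfg p
      redeiReichardt_fourTwoCard_classGroup_holds hp hp2 hinj h8', hRfun, hBfun]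
    exact hσ
  have hsel : Nat.card ((congruentNumberCurve n).selmerGroup 2) = 8 := by
    subst hn
    rw [monsky_card_selmerGroup_two_even_holds 3 p hp hodd hinj, hs]
    norm_num
  exact rankOne_sha_bsdp_two_congruentNumberCurve_of_selmerEight_six_noGZK hTYZ hsq h8 hsel hgen

end EvenAtlas

/-! ## §5 (APPENDED) Class `5`, `ω(n) = 3`, off the exceptional configuration, without GZK -/

section AtlasFive

variable (p : Fin 3 → ℕ)

/-- **CLASS `5`, `ω(n) = 3`, WITHOUT GZK: `s(n) = 1` OFF THE EXCEPTIONAL CONFIGURATION.** For distinct primes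
with `p₀p₁p₂ ≡ 5 (mod 8)`, a `2`-element kernel of Monsky's matrix, and configuration NOT `p₅·q₇·r₇` with
`(q/p) = (r/p) = −1` (`exceptionalFiveCfg … = false`): `r_an = 1`, rank `1`, `Ш[2^∞] = 0`, `BSD(E_n, 2)` —
modulo `hTYZ` ALONE (twin of `rankOne_sha_bsdp_two_congruentNumberCurve_three_primes_five{,_descent}`, which
display `hGZK` (+ `hM`, `hR`)). On the exceptional family nothing is claimed (genus sums even, TYZ silent).
[cite: TianYuanZhang2017, Thm. 3.5 and its proof; §1 (1.1)]
[cite: HeathBrown1994SelmerCongruentII, Appendix (Monsky), typescript p. 39 L10–L33]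
[cite: Miller2011LMS, Def. 1.1 (arXiv:1010.2431 p. 3)] -/
theorem rankOne_sha_bsdp_two_congruentNumberCurve_three_primes_five_noGZK (hTYZ : tyz_genusPointData)
    (hp : ∀ i, (p i).Prime) (hinj : Function.Injective p) {n : ℕ} (hn : ∏ i, p i = n)
    (h5 : n % 8 = 5)
    (hker : Fintype.card {v : Fin 3 ⊕ Fin 3 → ZMod 2 // monskyMatrixOdd p *ᵥ v = 0} = 2)
    (hexc : exceptionalFiveCfg (fun i => p i % 8) (fun a b => kroneckerBit (p b) (p a)) = false) :
    haveI := isElliptic_congruentNumberCurve (hn ▸ (squarefree_prod_of_injective p hp hinj).ne_zero)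
    (congruentNumberCurve n).analyticRank = 1 ∧ (congruentNumberCurve n).mordellWeilRank = 1 ∧
      AddCommGroup.primaryComponent (congruentNumberCurve n).sha 2 = ⊥ ∧
      BSDp (congruentNumberCurve n) 2 := by
  have hn3 : n = p 0 * p 1 * p 2 := by rw [← hn, Fin.prod_univ_three]
  have hp2 : ∀ i, p i ≠ 2 := by
    intro i hi
    have hdvd : p i ∣ n := hn ▸ Finset.dvd_prod_of_mem p (Finset.mem_univ i)
    rw [hi] at hdvd
    omega
  obtain ⟨r₀, r₁, r₂, ⟨e₀, e₁, e₂⟩, hRfun, hBfun⟩ := cfg_three_eq_betaOf p hp hp2 hinj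
  have h5r : (r₀.val * r₁.val * r₂.val) % 8 = 5 := by
    rw [e₀, e₁, e₂, mod_eight_mul_three, ← hn3, h5]
  have hkerC := hker
  rw [card_ker_monskyMatrixOdd_eq_cfg p hp hp2 hinj, hRfun, hBfun] at hkerC
  rw [hRfun, hBfun] at hexc
  have hsig := (sigmaCfg_iff_of_card_ker_five r₀ r₁ r₂ _ _ _ h5r hkerC).mpr hexc
  have hgood : doorACfg (fun i => p i % 8) (fun a b => kroneckerBit (p b) (p a)) = true := by
    rw [hRfun, hBfun, doorACfg_eq_true_iff]
    exact ⟨Or.inl h5r, hkerC, hsig⟩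
  exact rankOne_sha_bsdp_two_congruentNumberCurve_of_doorACfg_noGZK p hTYZ hp hinj hn hgood

end AtlasFive

end Summit.BirchSwinnertonDyer.Rank1Residual.P2

end
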